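import Summits.CriticalPhenomena.CardyFormulaZ2.Theorems.CardySelfRefinementCriticalPathRSW
import Summits.CriticalPhenomena.CardyFormulaZ2.Theorems.CardySelfRefinementDefs
import Literature.Probability.Percolation.ZdFourArmSeparated
import HarnessLib

/-!
# LINE `arm_separation_rung` on crux `TrivialSectorRate` (stmt-CriticalPhenomena-10266) —
# next rung over `CriticalPathRSW` (seed g1-CriticalPhenomena-10267): Kesten's four-arm
# separation for the self-refinement laws `M_k(γ s)` UNIFORMLY ALONG the RSW path

LINE HEADER (rung-harvest `fwd-harvest-CriticalPhenomena-04`, 2026-08-17; source seat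
`fwd-rung-CriticalPhenomena-04`, whose `Sketch.lean` is §1–§3 below VERBATIM except that the two §3 stubs are written out in full —
definitionally the same statements — so that their registered signatures are the statements; §4 is the
registration layer added by the harvest seat — two name-keyed stub aliases and the composition `RungTop_of`
concluding the rung BY NAME with the floor discharged from the seed theorem):
* route = `route-CriticalPhenomena-CardySelfRefinement`; crux = `Theses.CardySelfRefinement.TrivialSectorRate`
  (stmt-CriticalPhenomena-10266; also serves `GradientComparability`, stmt-CriticalPhenomena-10269);
* rung_decl = `Summit.CriticalPhenomena.CardyFormulaZ2.Cruxes.TrivialSectorRate.ArmSeparationRung.Rung` (at `⊤`;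
  constant form `RungTop`, §4);
* rung_of (floor) = `Summit.CriticalPhenomena.CardyFormulaZ2.Theses.CardySelfRefinement.CriticalPathRSW`;
  witness = `Summit.CriticalPhenomena.CardyFormulaZ2.Theorems.CriticalPathRSW_proof` (`Rung 1` ↔ floor, no sorry:
  `Lines/arm_separation_rung_special.lean`);
* stubs (registered obligations) = `stub_bulkSeparation : BulkSeparation`, `stub_cornerSeparation : CornerSeparation`;
  composition `RungTop_of : Registered.stub_bulkSeparation → Registered.stub_cornerSeparation → RungTop` (real proof);
* this line does NOT conclude the crux `TrivialSectorRate` (no honest composition exists: the rung is the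
  common prerequisite of the crux's (HB) stub and of the ENGINE's IIC step — `BlockedOnArmSeparation.md` §6 —
  and sits on the FRONTIER ladder below the engine's rate; card `Lines/arm-separation-rung.md`, idea
  `Ideas/arm-separation-rung.md`, ladder `LADDER-rung.md` of the source folder).


Forward generator G1 (`fwd-rung-CriticalPhenomena-04`), planner sketch — statements only, nothing
asserted (`sorry` appears only in the two named stubs of §3, which are the SPEC of the rung's own
two-piece plan; the composition `rung_top_of` is a real proof).

FLOOR (proved, `Theorems.CriticalPathRSW_proof`): for `k = 2, 3` there is an admissible parameter
path `γ` (`PathOK k γ`: continuous, `(1,0) → (0,½)`, BV, two-sided box-crossing bounds for every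
aspect ratio uniform in `s`) for the self-refinement bond models `M_k(ρ,c)` on `ℤ²`.

RUNG (this file): along EVERY such path the alternating four-arm event of the square annulus
`A_{n,N}` (`fourArmTwoClusters n N`, cluster form) is comparable to its WELL-SEPARATED (fenced,
landed) version `zdFourArmSep n N` (Kesten 1987 Lemmas 4–5 / Nolin 2008 Thm 11 / DMT 2021
Prop 6.2 shape), with constants uniform in the path parameter `s` — the one technology both open
crux programmes of route `CardySelfRefinement` above this floor name as missing
(`Cruxes/TrivialSectorRate/BlockedOnArmSeparation.md` §6; `Cruxes/GradientComparability/Lines/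
monotone-product-coordinates-sliceKesten-blueprint.md` "SEP").

GRADED FAMILY (one parameter extended): `FourArmSeparationAlong k γ L` asserts the separation
inequality for scale pairs `n₀ ≤ n`, `2n ≤ N ≤ L·n` only, `L : ℕ∞` the SCALE-RATIO HORIZON.
* `L = 1`: the scale clause is empty — `Rung 1` IS the floor (`bc/Rung_special.lean`, from
  `CriticalPathRSW_proof` in six lines);
* `L < ⊤`: bounded ratio — the floor's own technique class (RSW + FKG gluing builds fenced arms at
  cost `c(L) > 0`; cf. the tree's bounded-ratio input of `ZdFourArmBoundedRatio.lean`, proved from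
  RSW for Bernoulli bond-`ℤ²`);
* `L = ⊤`: UNIFORM in the ratio — Kesten's separation theorem for the dependent family, the rung.
The Statement (`CardyFormulaZ2`) is not a member of this family; the rung sits on the parent route's
ladder below `TrivialSectorRate` / `GradientComparability` (see the folder's `LADDER-rung.md`).
-/

noncomputable section

namespace Summit.CriticalPhenomena.CardyFormulaZ2.Cruxes.TrivialSectorRate.ArmSeparationRung

open Set MeasureTheory
open Literature.Probability.LatticeModels Literature.Probability.Percolation
open Summit.CriticalPhenomena.CardyFormulaZ2.Theorems.CardySelfRefinement

/-! ## §1 The graded family and the rung -/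

/-- **Four-arm separation along `γ` up to scale-ratio horizon `L`.**  There are `n₀` and `c > 0`
such that for every path parameter `s` and all scales `n₀ ≤ n`, `2n ≤ N`, `N ≤ L·n`,
`c · M_k(γ s)(fourArmTwoClusters n N) ≤ M_k(γ s)(zdFourArmSep n N)` (annuli centred at the coarse
vertex `0`; the other coarse centres follow by the `kℤ²`-periodicity of `M_k`). -/
def FourArmSeparationAlong (k : ℕ) (γ : unitInterval → ℝ × ℝ) (L : ℕ∞) : Prop :=
  ∃ n₀ : ℕ, ∃ c : ℝ, 0 < c ∧ ∀ (s : unitInterval) (n N : ℕ), n₀ ≤ n → 2 * n ≤ N →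
    (N : ℕ∞) ≤ L * (n : ℕ∞) →
      c * (M k (γ s).1 (γ s).2).real (fourArmTwoClusters n N) ≤
        (M k (γ s).1 (γ s).2).real (zdFourArmSep n N)

/-- **The graded family `Rung L`** (`L : ℕ∞`): the floor (an admissible RSW path exists for
`k = 2, 3`) AND four-arm separation up to horizon `L` along every admissible path.
`Rung 1` = the floor; `Rung ⊤` = the rung. -/
def Rung (L : ℕ∞) : Prop :=
  ∀ k : ℕ, k = 2 ∨ k = 3 →
    (∃ γ : unitInterval → ℝ × ℝ, PathOK k γ) ∧
      ∀ γ : unitInterval → ℝ × ℝ, PathOK k γ → FourArmSeparationAlong k γ L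

/-- The rung is monotone in the horizon (bookkeeping). -/
theorem fourArmSeparationAlong_mono {k : ℕ} {γ : unitInterval → ℝ × ℝ} {L L' : ℕ∞} (hLL' : L ≤ L')
    (h : FourArmSeparationAlong k γ L') : FourArmSeparationAlong k γ L := by
  obtain ⟨n₀, c, hc, h⟩ := h
  exact ⟨n₀, c, hc, fun s n N hn hnN hL => h s n N hn hnN (hL.trans (by gcongr))⟩

theorem rung_mono {L L' : ℕ∞} (hLL' : L ≤ L') (h : Rung L') : Rung L := fun k hk =>
  ⟨(h k hk).1, fun γ hγ => fourArmSeparationAlong_mono hLL' ((h k hk).2 γ hγ)⟩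

/-! ## §2 The rung's own two-piece plan (regime split along the path; first lemmas)

The admissible path runs from the COARSE corner `(1,0)` (interior edges closed: bond percolation on
`kℤ²`) to `(0,½)` (plain bond-`ℤ²`).  Two-sided finite energy of the interior (non-axial) coins holds
exactly on `{c ≥ c₀}`; near the coarse corner it fails one-sidedly (`c(s) → 0`), which is where
every exploration argument of the parent's leads broke (`BlockedOnArmSeparation.md` §3).  Hence the
split: BULK (`(γ s).2 ≥ c₀`, every `c₀ > 0`) and COARSE CORNER (`(γ s).2 ≤ c₀`, some `c₀ > 0`). -/

/-- **Bulk separation** (every `c₀ > 0`): four-arm separation, uniform over the path parameters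
with interior density `(γ s).2 ≥ c₀`.  Technique: Kesten–Nolin induction on dyadic scales (tree:
`le_mul_of_separationScheme_upto`, measure-free) fed by one-scale surgeries for a BLOCK-FACTOR FKG
model — independence across tile-separated edge sets replaces independence of disjoint sets,
Nolin's lowest-crossing conditioning (Lemma 14) is run with a `k`-contamination layer repaired by
two-sided finite energy of the interior coins (bias in `[c₀, 1-δ]`), BK on the coin space only for
tile-separated witnesses (templates: Vanneuville 2019 §7 "good point configuration"; CDH 2016 §5.1 /
DMT 2021 Prop. 6.2 for FK). -/
def BulkSeparation : Prop :=
  ∀ k : ℕ, k = 2 ∨ k = 3 → ∀ γ : unitInterval → ℝ × ℝ, PathOK k γ → ∀ c₀ : ℝ, 0 < c₀ →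
    ∃ n₀ : ℕ, ∃ c : ℝ, 0 < c ∧ ∀ (s : unitInterval) (n N : ℕ), c₀ ≤ (γ s).2 → n₀ ≤ n → 2 * n ≤ N →
      c * (M k (γ s).1 (γ s).2).real (fourArmTwoClusters n N) ≤
        (M k (γ s).1 (γ s).2).real (zdFourArmSep n N)

/-- **Coarse-corner separation** (some `c₀ > 0`): four-arm separation, uniform over the path
parameters with `(γ s).2 ≤ c₀`.  Technique: at `c = 0` the model is Bernoulli bond percolation on
the coarse lattice `kℤ²` (Kesten's theorem verbatim at scale `k`); for `c ≤ c₀` open interior edges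
are a sparse independent decoration (long non-axial open stretches cost `(3c₀)^ℓ`), all open
surgeries are routed along axial bundles (cost `≥ 2^{-k}` per sub-edge, uniform in `(ρ,c)`), closed
surgeries are free (`1 - c ≥ 1 - c₀`). -/
def CornerSeparation : Prop :=
  ∀ k : ℕ, k = 2 ∨ k = 3 → ∀ γ : unitInterval → ℝ × ℝ, PathOK k γ → ∃ c₀ : ℝ, 0 < c₀ ∧
    ∃ n₀ : ℕ, ∃ c : ℝ, 0 < c ∧ ∀ (s : unitInterval) (n N : ℕ), (γ s).2 ≤ c₀ → n₀ ≤ n → 2 * n ≤ N →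
      c * (M k (γ s).1 (γ s).2).real (fourArmTwoClusters n N) ≤
        (M k (γ s).1 (γ s).2).real (zdFourArmSep n N)

/-! ## §3 Skeleton: the two stubs and the (proved) composition -/

/-- STUB · bulk separation (open; size XL; the transplant of Kesten's theorem to the dependent
family where finite energy is two-sided).  Stated in full (definitionally `BulkSeparation`) so that the
registered signature is the statement itself, matchable by a `Theorems/` proof `--supports` the crux. -/
theorem stub_bulkSeparation :
    ∀ k : ℕ, k = 2 ∨ k = 3 → ∀ γ : unitInterval → ℝ × ℝ, PathOK k γ → ∀ c₀ : ℝ, 0 < c₀ →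
      ∃ n₀ : ℕ, ∃ c : ℝ, 0 < c ∧ ∀ (s : unitInterval) (n N : ℕ), c₀ ≤ (γ s).2 → n₀ ≤ n → 2 * n ≤ N →
        c * (M k (γ s).1 (γ s).2).real (fourArmTwoClusters n N) ≤
          (M k (γ s).1 (γ s).2).real (zdFourArmSep n N) := by
  sorry

/-- STUB · coarse-corner separation (open; size L; perturbative around Bernoulli on `kℤ²`).  Stated
in full (definitionally `CornerSeparation`). -/
theorem stub_cornerSeparation :
    ∀ k : ℕ, k = 2 ∨ k = 3 → ∀ γ : unitInterval → ℝ × ℝ, PathOK k γ → ∃ c₀ : ℝ, 0 < c₀ ∧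
      ∃ n₀ : ℕ, ∃ c : ℝ, 0 < c ∧ ∀ (s : unitInterval) (n N : ℕ), (γ s).2 ≤ c₀ → n₀ ≤ n → 2 * n ≤ N →
        c * (M k (γ s).1 (γ s).2).real (fourArmTwoClusters n N) ≤
          (M k (γ s).1 (γ s).2).real (zdFourArmSep n N) := by
  sorry

/-- **Composition** (real proof): the floor plus the two regime pieces give the rung `Rung ⊤`. -/
theorem rung_top_of (hfloor : ∀ k : ℕ, k = 2 ∨ k = 3 → ∃ γ : unitInterval → ℝ × ℝ, PathOK k γ)
    (hbulk : BulkSeparation) (hcorner : CornerSeparation) : Rung ⊤ := by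
  intro k hk
  refine ⟨hfloor k hk, fun γ hγ => ?_⟩
  obtain ⟨c₀, hc₀, n₁, c₁, hc₁, h₁⟩ := hcorner k hk γ hγ
  obtain ⟨n₂, c₂, hc₂, h₂⟩ := hbulk k hk γ hγ c₀ hc₀
  refine ⟨max n₁ n₂, min c₁ c₂, lt_min hc₁ hc₂, fun s n N hn hnN _ => ?_⟩
  have hμ : 0 ≤ (M k (γ s).1 (γ s).2).real (fourArmTwoClusters n N) := measureReal_nonneg
  rcases le_total (γ s).2 c₀ with hs | hs
  · calc min c₁ c₂ * (M k (γ s).1 (γ s).2).real (fourArmTwoClusters n N)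
        ≤ c₁ * (M k (γ s).1 (γ s).2).real (fourArmTwoClusters n N) :=
          mul_le_mul_of_nonneg_right (min_le_left _ _) hμ
      _ ≤ _ := h₁ s n N hs ((le_max_left _ _).trans hn) hnN
  · calc min c₁ c₂ * (M k (γ s).1 (γ s).2).real (fourArmTwoClusters n N)
        ≤ c₂ * (M k (γ s).1 (γ s).2).real (fourArmTwoClusters n N) :=
          mul_le_mul_of_nonneg_right (min_le_right _ _) hμ
      _ ≤ _ := h₂ s n N hs ((le_max_right _ _).trans hn) hnN

/-- The skeleton's output: the rung from the registered pieces (floor = `criticalPathRSW_iff` +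
the seed theorem, supplied by the caller so that this file does not import the proof cone). -/
theorem rung_top_of_stubs
    (hfloor : ∀ k : ℕ, k = 2 ∨ k = 3 → ∃ γ : unitInterval → ℝ × ℝ, PathOK k γ) : Rung ⊤ :=
  rung_top_of hfloor stub_bulkSeparation stub_cornerSeparation

/-! ## §4 Registration layer (harvest seat): name-keyed stub aliases and the composition BY NAME

The skeleton audit (`#h21_check_skeleton`) wants ONE theorem of this file concluding the registered decl BY
NAME whose `Prop` hypotheses are the registered stubs BY NAME.  `RungTop` is the rung `Rung ⊤` as a constant;
`Registered.stub_*` are the statements keyed by their stub names (definitionally `BulkSeparation`,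
`CornerSeparation`); the floor is discharged from the seed theorem `CriticalPathRSW_proof` through the
definitional bridge `criticalPathRSW_iff`, so `RungTop_of` has no other hypothesis.  No `sorry` below. -/

/-- The rung as a constant: four-arm separation for `M_k` uniformly along every admissible RSW path,
uniformly in the scale ratio (`Rung ⊤`). -/
def RungTop : Prop := Rung ⊤

theorem rungTop_iff : RungTop ↔ Rung ⊤ := Iff.rfl

/-- The floor in `PathOK` form, from the seed theorem (definitional bridge `criticalPathRSW_iff`). -/
theorem floor_pathOK : ∀ k : ℕ, k = 2 ∨ k = 3 → ∃ γ : unitInterval → ℝ × ℝ, PathOK k γ :=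
  criticalPathRSW_iff.mp Summit.CriticalPhenomena.CardyFormulaZ2.Theorems.CriticalPathRSW_proof

/-! ### Consistency: each named statement IS its registered stub (definitionally) -/

theorem bulkSeparation_holds : BulkSeparation := stub_bulkSeparation
theorem cornerSeparation_holds : CornerSeparation := stub_cornerSeparation

namespace Registered

/-- Alias of `BulkSeparation`, keyed by the registered stub name. -/
abbrev stub_bulkSeparation : Prop := BulkSeparation
/-- Alias of `CornerSeparation`, keyed by the registered stub name. -/
abbrev stub_cornerSeparation : Prop := CornerSeparation

end Registered

/-- **Composition BY NAME** (kernel-checked, no `sorry`): the two registered stubs give the rung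
`RungTop` (= `Rung ⊤`); the floor comes from the seed theorem. -/
theorem RungTop_of (hbulk : Registered.stub_bulkSeparation) (hcorner : Registered.stub_cornerSeparation) :
    RungTop :=
  rung_top_of floor_pathOK hbulk hcorner

/-- Every rung contains the floor (informational converse; with `Lines/arm_separation_rung_special.lean`
this gives `Rung 1 ↔ CriticalPathRSW`). -/
theorem criticalPathRSW_of_rung (L : ℕ∞) (h : Rung L) :
    Summit.CriticalPhenomena.CardyFormulaZ2.Theses.CardySelfRefinement.CriticalPathRSW :=
  criticalPathRSW_iff.mpr fun k hk => (h k hk).1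

end Summit.CriticalPhenomena.CardyFormulaZ2.Cruxes.TrivialSectorRate.ArmSeparationRung

end
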